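import Summits.Langlands.Langlands.Theorems.ParityBlindBianchiTwoAdicBianchiProModularityLevelHeckePolynomialNilpotent
import Literature.NumberTheory.Automorphic.RegularAlgebraicCuspidalHeckePointProofs
import Summits.Langlands.Langlands.Theses.ParityBlindBianchi
import HarnessLib

/-!
# `TwoAdicBianchiProModularityLevel` (crux stmt-Langlands-15110, route `ParityBlindBianchi`) —
# COARSE-TOWER TRANSFER: degree-bounded points of `Spf 𝕋` of a COARSER tower are points of `Spf 𝕋`
# of the finer (principal `2`-power) tower, whatever the indices

Generic vocabulary of `CompletedCohomology` (`Γ → 𝒢`, towers, Hecke elements `δ : J → 𝒢`,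
coefficients `k`, `ϖ`).  The conclusion of the crux is a point of `Spf 𝕋(U^2)` of the PRINCIPAL
`2`-power tower `K'(s) = U ∩ K((2)^s)`.  Mechanisms that produce `2`-adic eigensystems — Hida's ordinary
families (crux idea `two-ordinary-typed-patching`; tree `TameLevel.hidaTower`: Iwahori-type levels
`Iw_v(s, s)` at the places over `2`), `Γ₀/Γ₁((2)^s)`-towers, classical newforms of non-principal level at
`2` — live on COARSER towers `K(s) ⊇ K'(s)`, and the indices `[K(s) : K'(s)]` are UNBOUNDED in `s` (the
Hida tower contains the integral upper unipotents at every step), so the restriction–transfer mechanism of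
`…OddIndexLevelChange` / `…FiniteIndexLevelChange` (leads c9, c11: indices dividing ONE absorbed `N`)
does not apply.  Here the index is irrelevant: by `pow_succ_lift_heckeEnd_eq_zero`
(`…HeckePolynomialNilpotent`, the Hochschild–Serre reduction of [Scholze2015, §V.4, proof of Thm. V.4.1]
for `K'` NORMAL in `K`) an abstract Hecke operator `P ∈ k⟨T_j⟩` killing the pieces `(b, s, t')`, `b ≤ i`,
of the fine tower has `P^{i+1} = 0` on the piece `(i, s, t')` of the coarse tower; a point `χ` of `Spf 𝕋`
of the coarse tower whose stage-`t` witnesses have DEGREES `≤ Q` therefore satisfies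
`P(χ)^{Q+1} ∈ (ϖ^{t(Q+1)})`, whence `P(χ) ∈ (ϖ^t)` as soon as `k` absorbs powers (`ℤ̄₂` does: a
valuation ring).  What is paid is `2`-adic depth (`(Q+1)`-fold), what is needed is a DEGREE bound on the
witnesses (automatic for eigensystems read in degrees `≤ vcd`), never an index bound.

* §4 **`IsHeckePoint.of_coarser_of_degreeBounded`** (+ `degreeBounded_kernelForm_of_algHom`, the
  degree-tracking `⇒` half of `isHeckePoint_iff_forall_freeAlgebra`);
* §5 `pow_absorb_valuationSubring_two` (`x^{n+1} ∈ (2^{t(n+1)}) ⇒ x ∈ (2^t)` in `ℤ̄₂`);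
* §6 `crux_isHeckePoint_of_coarser_degreeBounded` — the crux's literal setting (`Γ = GL₂(K) →
  GL₂(𝔸_K^∞)`, Hecke family `(v, i) ↦ (t_{v,i+1})_f`, `k = ℤ̄₂`, `ϖ = 2`), registered sub-goal.

Bearing on the crux / on a re-cut E2′_ord (lead a1 dossier `Cruxes/…/Lines/SketchIdeator4.dead.md` §3):
an item concluding DEGREE-BOUNDED occurrence of σ's eigensystem at ANY `2`-power level structure inside
`U` (Iwahori / Hida level, `ℤ̄₂`-coefficients) yields the `IsHeckePoint` clause of
`TwoAdicBianchiProModularityLevel` by this file plus adelic plumbing; the bare tree predicate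
`TameLevel.IsOrdinarilyPadicallyAutomorphic` (witnesses of uncontrolled degree) does not.

Sorry-free, definition-free; lead a1 (line `SketchIdeator4` assessment, cycle 1).

## References

* P. Scholze, *On torsion in the cohomology of locally symmetric varieties*, Ann. of Math. 182 (2015),
  §V.4, proof of Thm. V.4.1 and of Cor. V.4.2 [Scholze2015].
-/

noncomputable section

set_option linter.dupNamespace false

namespace Summit.Langlands.Langlands.Theorems.TwoAdicBianchiProModularityLevel

open CategoryTheory Literature.NumberTheory.Automorphic

universe u v

/-! ### §4 Coarse-tower transfer: degree-bounded points of `Spf 𝕋` of a coarser tower are points of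
`Spf 𝕋` of the finer tower -/

section Tower

variable {k Γ 𝒢 : Type u} [CommRing k] [Group Γ] [Group 𝒢] {ι : Γ →* 𝒢}
  {T T' : LevelTower 𝒢} {ϖ : k} {J : Type v} {δ : J → 𝒢} {χ : J → k}

/-- **Degree-bounded points, algebra form ⇒ kernel form.**  If for every `t` the assignment
`T_{δ j} ↦ χ j mod ϖ^t` extends to a `k`-algebra homomorphism `𝕋(T) → k/ϖ^t` factoring through the
restriction to finitely many pieces `(i, s, t')` of DEGREE `i ≤ Q`, then every abstract Hecke operator
killing those pieces has `P(χ) ∈ (ϖ^t)` (the `⇒` half of `isHeckePoint_iff_forall_freeAlgebra`, keeping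
track of the degrees). [cite: Scholze2015, §V.4, proof of Cor. V.4.2] -/
theorem degreeBounded_kernelForm_of_algHom {Q : ℕ}
    (h : ∀ t : ℕ, ∃ (I : Finset TowerIndex) (φ : bigHeckeAlgebra k ι T ϖ δ →ₐ[k] modPow k ϖ t),
      (∀ z ∈ I, z.1 ≤ Q) ∧
        (∀ x y : bigHeckeAlgebra k ι T ϖ δ, (∀ z ∈ I, x.1 z = y.1 z) → φ x = φ y) ∧
          ∀ j, φ ⟨towerHeckeFamily k ι T ϖ (δ j), towerHeckeFamily_mem_bigHeckeAlgebra k ι T ϖ δ j⟩ =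
            Ideal.Quotient.mk _ (χ j)) :
    ∀ t : ℕ, ∃ I : Finset TowerIndex, (∀ z ∈ I, z.1 ≤ Q) ∧ ∀ P : FreeAlgebra k J,
      (∀ z ∈ I, FreeAlgebra.lift k (fun j => towerHeckeFamily k ι T ϖ (δ j)) P z = 0) →
        FreeAlgebra.lift k χ P ∈ Ideal.span {ϖ ^ t} := by
  intro t
  obtain ⟨I, φ, hIQ, hcont, hval⟩ := h t
  refine ⟨I, hIQ, fun P hP => ?_⟩
  rw [← Ideal.Quotient.eq_zero_iff_mem, ← algHom_lift_eq_mk φ hval P, ← map_zero φ]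
  refine hcont _ _ fun z hz => ?_
  rw [val_lift_bigHeckeAlgebra, hP z hz]
  rfl

/-- **COARSE-TOWER TRANSFER.**  Let `T'` be a finer tower than `T` (`K'(s) ≤ K(s)` with `K'(s)`
NORMAL in `K(s)` — no bound on the indices `[K(s) : K'(s)]`), with Hecke elements `δ_j` such that
`l δ_j l⁻¹ ∈ K'(s) δ_j K'(s)` for `l ∈ K(s)` and `K'(s) δ_j K'(s)/K'(s) → K(s) δ_j K(s)/K(s)` is a
bijection onto a finite set (e.g. `δ_j` supported at places where both towers are hyperspecial), and let
`k` absorb powers `ϖ`-adically (`x^{n+1} ∈ (ϖ^{t(n+1)}) ⇒ x ∈ (ϖ^t)`, e.g. a valuation ring with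
`ϖ ≠ 0`).  If `χ` is a point of `Spf 𝕋` of the COARSE tower `T` whose stage-`t` witnesses have degrees
`≤ Q` (kernel form), then `χ` is a point of `Spf 𝕋` of the FINE tower `T'`: an abstract Hecke operator
`P` killing the pieces `(b, s, t')`, `b ≤ i`, of `T'` has `P^{i+1} = 0` on the piece `(i, s, t')` of `T`
(`pow_succ_lift_heckeEnd_eq_zero`), so `P(χ)^{Q+1} ∈ (ϖ^{t(Q+1)})` and `P(χ) ∈ (ϖ^t)`.  This is the
Hochschild–Serre mechanism by which eigensystems of ANY level between `U ∩ K(p^s)` and `U` (Iwahori,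
`Γ₀/Γ₁(p^s)`, Hida's `Iw(s,s)`, …) are points of the big Hecke algebra of the principal `p`-power
tower, at the cost of reading the point `(Q+1)`-times deeper. [cite: Scholze2015, §V.4, proof of Thm. V.4.1] -/
theorem IsHeckePoint.of_coarser_of_degreeBounded (hle : ∀ s : ℕ, T'.level s ≤ T.level s)
    [hN : ∀ s : ℕ, ((T'.level s).subgroupOf (T.level s)).Normal]
    (hconj : ∀ (s : ℕ) (j : J) (l : T.level s), ∃ a ∈ T'.level s, ∃ b ∈ T'.level s,
      (l : 𝒢) * δ j * (l : 𝒢)⁻¹ = a * δ j * b)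
    (hfin' : ∀ (s : ℕ) (j : J), (ArithmeticQuotient.doubleCosetQuot (T'.level s) (δ j)).Finite)
    (hbij : ∀ (s : ℕ) (j : J), Set.BijOn (fun c => (1 : 𝒢)⁻¹ • ArithmeticQuotient.translateQuot (1 : 𝒢)
        (ArithmeticQuotient.conjInto_one_iff.2 (hle s)) c)
      (ArithmeticQuotient.doubleCosetQuot (T'.level s) (δ j))
      (ArithmeticQuotient.doubleCosetQuot (T.level s) (δ j)))
    (hfin : ∀ (s : ℕ) (j : J), (ArithmeticQuotient.doubleCosetQuot (T.level s) (δ j)).Finite)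
    (habs : ∀ (n t : ℕ) (x : k), x ^ (n + 1) ∈ Ideal.span {ϖ ^ (t * (n + 1))} → x ∈ Ideal.span {ϖ ^ t})
    {Q : ℕ}
    (h : ∀ t : ℕ, ∃ I : Finset TowerIndex, (∀ z ∈ I, z.1 ≤ Q) ∧ ∀ P : FreeAlgebra k J,
      (∀ z ∈ I, FreeAlgebra.lift k (fun j => towerHeckeFamily k ι T ϖ (δ j)) P z = 0) →
        FreeAlgebra.lift k χ P ∈ Ideal.span {ϖ ^ t}) :
    IsHeckePoint ι T' ϖ δ χ := by
  classical
  -- the `z`-component of the diagonal action of an abstract Hecke operator is its action on the piece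
  -- `z` (the tree's `lift_towerHeckeFamily_apply`, `…OddIndexLevelChange`, in this file's universes)
  have happ : ∀ (T₀ : LevelTower 𝒢) (P : FreeAlgebra k J) (z : TowerIndex),
      FreeAlgebra.lift k (fun j => towerHeckeFamily k ι T₀ ϖ (δ j)) P z =
        FreeAlgebra.lift k (fun j => towerHeckeFamily k ι T₀ ϖ (δ j) z) P := fun T₀ P z => by
    have hcomp : (FreeAlgebra.lift k fun j => towerHeckeFamily k ι T₀ ϖ (δ j) z) =
        (Pi.evalAlgHom k (fun x : TowerIndex =>
          Module.End k (towerCohomology k ι T₀ ϖ x.1 x.2.1 x.2.2)) z).comp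
            (FreeAlgebra.lift k fun j => towerHeckeFamily k ι T₀ ϖ (δ j)) := by
      refine FreeAlgebra.hom_ext (funext fun j => ?_)
      simp only [Function.comp_apply, AlgHom.comp_apply, FreeAlgebra.lift_ι_apply]
      rfl
    rw [hcomp]
    rfl
  rw [isHeckePoint_iff_forall_freeAlgebra]
  intro t
  obtain ⟨I, hIQ, hI⟩ := h (t * (Q + 1))
  refine ⟨I.biUnion fun z => (Finset.range (z.1 + 1)).image fun b => (b, z.2), fun P hP => ?_⟩
  apply habs Q t
  rw [← map_pow]
  refine hI _ fun z hz => ?_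
  rw [map_pow, Pi.pow_apply, happ]
  obtain ⟨i, s, t'⟩ := z
  have hi : i ≤ Q := hIQ _ hz
  have hpow := pow_succ_lift_heckeEnd_eq_zero ι (hle s) (modPow k ϖ t') δ (hconj s) (hfin' s)
    (hbij s) (hfin s) P i (fun b hb => by
      have hz' : ((b, s, t') : TowerIndex) ∈
          I.biUnion fun z => (Finset.range (z.1 + 1)).image fun b => (b, z.2) :=
        Finset.mem_biUnion.2 ⟨(i, s, t'), hz, Finset.mem_image.2 ⟨b, Finset.mem_range.2 (by omega), rfl⟩⟩
      have h0 := hP _ hz'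
      rwa [happ] at h0)
  exact pow_eq_zero_of_le (by omega) hpow

end Tower

/-! ### §5 `ℤ̄₂` absorbs powers `2`-adically -/

section Absorb

/-- **`ℤ̄₂` absorbs powers**: in the valuation ring `ℤ̄₂` of `ℚ̄₂`, `x^{n+1} ∈ (2^{t(n+1)})` implies
`x ∈ (2^t)` (valuation rings are integrally closed: `v(x/2^t)^{n+1} ≤ 1 ⇒ v(x/2^t) ≤ 1`). [folklore] -/
theorem pow_absorb_valuationSubring_two (n t : ℕ) (x : (PadicAlgCl.valued 2).v.valuationSubring)
    (hx : x ^ (n + 1) ∈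
      Ideal.span {((2 : ℕ) : (PadicAlgCl.valued 2).v.valuationSubring) ^ (t * (n + 1))}) :
    x ∈ Ideal.span {((2 : ℕ) : (PadicAlgCl.valued 2).v.valuationSubring) ^ t} := by
  rw [Ideal.mem_span_singleton] at hx ⊢
  obtain ⟨y, hy⟩ := hx
  have h2 : ((2 : ℕ) : PadicAlgCl 2) ≠ 0 := by exact_mod_cast (two_ne_zero : (2 : PadicAlgCl 2) ≠ 0)
  have hyK : ((x : PadicAlgCl 2)) ^ (n + 1) =
      ((2 : ℕ) : PadicAlgCl 2) ^ (t * (n + 1)) * (y : PadicAlgCl 2) := by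
    have := congrArg (fun w : (PadicAlgCl.valued 2).v.valuationSubring => (w : PadicAlgCl 2)) hy
    push_cast at this
    exact this
  set z : PadicAlgCl 2 := (x : PadicAlgCl 2) / ((2 : ℕ) : PadicAlgCl 2) ^ t with hzdef
  have hxz : (x : PadicAlgCl 2) = ((2 : ℕ) : PadicAlgCl 2) ^ t * z := by
    rw [hzdef, mul_div_cancel₀ _ (pow_ne_zero _ h2)]
  have hz : z ^ (n + 1) = (y : PadicAlgCl 2) := by
    have hne : ((2 : ℕ) : PadicAlgCl 2) ^ (t * (n + 1)) ≠ 0 := pow_ne_zero _ h2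
    apply mul_left_cancel₀ hne
    rw [← hyK, hxz, mul_pow, ← pow_mul]
  have hzO : z ∈ (PadicAlgCl.valued 2).v.valuationSubring := by
    rw [Valuation.mem_valuationSubring_iff]
    have hy1 : (PadicAlgCl.valued 2).v (y : PadicAlgCl 2) ≤ 1 :=
      (Valuation.mem_valuationSubring_iff _ _).1 y.2
    rw [← hz, map_pow] at hy1
    exact (pow_le_one_iff_of_nonneg zero_le (Nat.succ_ne_zero n)).1 hy1
  refine ⟨⟨z, hzO⟩, Subtype.ext ?_⟩
  push_cast
  exact hxz

end Absorb

/-! ### §6 The crux's setting: `k = ℤ̄₂`, `ϖ = 2`, `Γ = GL₂(K) → GL₂(𝔸_K^∞)` -/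

section Crux

open scoped NumberField
open IsDedekindDomain

/-- **Coarse-tower transfer, in the crux's vocabulary** (registered sub-goal).  For
`Γ = GL₂(K) → 𝒢 = GL₂(𝔸_K^∞)` diagonally, the Hecke family `(v, i) ↦ (t_{v,i+1})_f` over a type `S` of
(good) places, coefficients `ℤ̄₂`, `ϖ = 2`: let `T'` be a finer tower than `T` with `K'(s)` normal in
`K(s)` (for the crux: `T'` = the principal `2`-power tower `(U ∩ K((2)^s))_s` of its conclusion, `T` ANY
tower of levels `U ∩ K((2)^s) ≤ K(s) ≤ U` — Iwahori / `Γ₀((2)^s)` / Hida's `Iw_v(s,s)` at the places over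
`2`), whose good double cosets correspond bijectively and are finite (adelic plumbing, as in
`…FiniteIndexLevelChange`).  If the Hecke data `a` form a point of `Spf 𝕋` of the COARSE tower `T` with
stage-`t` witnesses of degree `≤ Q` (kernel form), they form a point of `Spf 𝕋` of the FINE tower `T'` —
with NO hypothesis on the (unbounded) indices `[K(s) : K'(s)]`.  Bearing on the crux: occurrence of σ's
eigensystem in bounded degrees at ANY `2`-power level structure inside `U` (e.g. an ordinary / Hida-family
point read at a finite Iwahori level) yields the `IsHeckePoint` clause of `TwoAdicBianchiProModularityLevel`.
[cite: Scholze2015, §V.4, proof of Thm. V.4.1] -/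
theorem crux_isHeckePoint_of_coarser_degreeBounded : ∀ (K : Type) [Field K] [NumberField K]
    (T T' : LevelTower (GL (Fin 2) (FiniteAdeleRing (𝓞 K) K))) (hle : ∀ s : ℕ, T'.level s ≤ T.level s)
    [∀ s : ℕ, ((T'.level s).subgroupOf (T.level s)).Normal]
    (S : Type) (pl : S → HeightOneSpectrum (𝓞 K))
    (ϖ : ∀ v : HeightOneSpectrum (𝓞 K), (v.adicCompletion K)ˣ)
    (a : S → ℕ → (PadicAlgCl.valued 2).v.valuationSubring) (Q : ℕ),
    (∀ (s : ℕ) (j : S × Fin 2) (l : T.level s), ∃ a' ∈ T'.level s, ∃ b' ∈ T'.level s,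
      (l : GL (Fin 2) (FiniteAdeleRing (𝓞 K) K)) *
          GLn.sndHom 2 K (heckeDiagAt 2 K (pl j.1) (ϖ (pl j.1)) (j.2.val + 1)) * (l : _)⁻¹ =
        a' * GLn.sndHom 2 K (heckeDiagAt 2 K (pl j.1) (ϖ (pl j.1)) (j.2.val + 1)) * b') →
    (∀ (s : ℕ) (j : S × Fin 2), (ArithmeticQuotient.doubleCosetQuot (T'.level s)
      (GLn.sndHom 2 K (heckeDiagAt 2 K (pl j.1) (ϖ (pl j.1)) (j.2.val + 1)))).Finite) →
    (∀ (s : ℕ) (j : S × Fin 2), Set.BijOn (fun c => (1 : GL (Fin 2) (FiniteAdeleRing (𝓞 K) K))⁻¹ •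
        ArithmeticQuotient.translateQuot (1 : GL (Fin 2) (FiniteAdeleRing (𝓞 K) K))
          (ArithmeticQuotient.conjInto_one_iff.2 (hle s)) c)
      (ArithmeticQuotient.doubleCosetQuot (T'.level s)
        (GLn.sndHom 2 K (heckeDiagAt 2 K (pl j.1) (ϖ (pl j.1)) (j.2.val + 1))))
      (ArithmeticQuotient.doubleCosetQuot (T.level s)
        (GLn.sndHom 2 K (heckeDiagAt 2 K (pl j.1) (ϖ (pl j.1)) (j.2.val + 1))))) →
    (∀ (s : ℕ) (j : S × Fin 2), (ArithmeticQuotient.doubleCosetQuot (T.level s)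
      (GLn.sndHom 2 K (heckeDiagAt 2 K (pl j.1) (ϖ (pl j.1)) (j.2.val + 1)))).Finite) →
    (∀ t : ℕ, ∃ I : Finset TowerIndex, (∀ z ∈ I, z.1 ≤ Q) ∧
      ∀ P : FreeAlgebra (PadicAlgCl.valued 2).v.valuationSubring (S × Fin 2),
        (∀ z ∈ I, FreeAlgebra.lift (PadicAlgCl.valued 2).v.valuationSubring
          (fun j : S × Fin 2 => towerHeckeFamily (PadicAlgCl.valued 2).v.valuationSubring
            (Matrix.GeneralLinearGroup.map (algebraMap K (FiniteAdeleRing (𝓞 K) K)) :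
              GL (Fin 2) K →* GL (Fin 2) (FiniteAdeleRing (𝓞 K) K))
            T ((2 : ℕ) : (PadicAlgCl.valued 2).v.valuationSubring)
            (GLn.sndHom 2 K (heckeDiagAt 2 K (pl j.1) (ϖ (pl j.1)) (j.2.val + 1)))) P z = 0) →
        FreeAlgebra.lift (PadicAlgCl.valued 2).v.valuationSubring (fun j : S × Fin 2 => a j.1 (j.2.val + 1)) P ∈
          Ideal.span {((2 : ℕ) : (PadicAlgCl.valued 2).v.valuationSubring) ^ t}) →
    IsHeckePoint
      (Matrix.GeneralLinearGroup.map (algebraMap K (FiniteAdeleRing (𝓞 K) K)) :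
        GL (Fin 2) K →* GL (Fin 2) (FiniteAdeleRing (𝓞 K) K))
      T' ((2 : ℕ) : (PadicAlgCl.valued 2).v.valuationSubring)
      (fun j : S × Fin 2 => GLn.sndHom 2 K (heckeDiagAt 2 K (pl j.1) (ϖ (pl j.1)) (j.2.val + 1)))
      (fun j => a j.1 (j.2.val + 1)) := by
  intro K _ _ T T' hle _ S pl ϖ a Q hconj hfin' hbij hfin hpt
  exact IsHeckePoint.of_coarser_of_degreeBounded hle hconj hfin' hbij hfin
    pow_absorb_valuationSubring_two hpt

end Crux



end Summit.Langlands.Langlands.Theorems.TwoAdicBianchiProModularityLevel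

end
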